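import Summits.QuantumFields.GaugeBoot.Rung0D3Binding
import Summits.QuantumFields.GaugeBoot.LoopEquationSU2
import HarnessLib

/-!
# Gauge-boot rung-0 truncation, `D = 3`, `SU(2)`: the two loop-equation rows ARE theorems of the torus theory

Cell `pub-gaugeboot` (HOME `run/shared/lean/pub/pub-gaugeboot/`), seat lean2 (task L1 follow-up), companion of lean1's
`Rung0D3Words` / `Rung0D3Canon` / `Rung0D3Binding` (variables `Rung0D3.y β L v = ⟨W_0(rep v)⟩`, `β` the STANDARD coupling,
tree coupling `β/2`).  GENERATED by `scratch/gen_rung0_leq.py` (seat folder) — the canonicalisation witnesses were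
found by search and are CHECKED here by `decide` through `LoopClasses.wilsonExpectation_wordLoop_canon`.

HONEST FRAMING (page 1 of every file of this cell): certified bounds on lattice expectations at STATED coupling, gauge
group, dimension and torus size; NOT a mass gap, NOT a continuum limit, NOT a string tension, NOT large `N`; NOT
Yang–Mills-summit-bearing (barriers `FixedCouplingUltralocality`, `PerturbativeInvisibility`).

The rows (1eq), (2eq) of every rung-0 `SU(2)`, `D = 3` problem file of the cell (hypotheses `h1eq`, `h2eq` of lean1's
`Rows/Rung0D3Rows*`) are the plaquette row and the spur-plaquette row of the one-link Schwinger–Dyson identity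
(`LoopEquationSU2.oneEq_su_two_wordLoop` / `twoEq_su_two_wordLoop`, from `LoopEquation.loopEquation_specialUnitaryGroup`)
at base point `0`, link `(0, +e₀)`, in-plane axis `1`: each of the 17 raw words occurring in them (the in-plane words of
the `d = 2` six-variable system and, per transverse axis, the bent / double-bent words) is carried to the representative
`rep v` of its variable by hyperoctahedral moves at the origin, reversal, rotation and backtrack reduction, all of which
preserve the torus expectation on EVERY torus `(ℤ/L)^3`; the rows need `L ≥ 2` (`(1 : ZMod L) ≠ 0`).  Results:
* `Rung0D3.oneEq` : `3·y1 + (β/2)·(y2 − 1 + y4 − y3 + 2(y8 − y7)) = 0`;  `Rung0D3.twoEq` : `(β/2)·(y3 − y4 + y5 − y6 + 2(y9 − y10)) = 0`;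
* normalised (`β ≠ 0`, `2 ≤ L`): `Rung0D3.oneEq_y` : `−1 + (6/β)·y1 + y2 − y3 + y4 − 2y7 + 2y8 = 0` (and `oneEq_y_of` with the
  coefficient `c`, `c·β = 6`, as the problem files print it), `Rung0D3.twoEq_y` : `−y3 + y4 − y5 + y6 − 2y9 + 2y10 = 0` —
  VERBATIM the hypotheses `h1eq`, `h2eq` of `Rows/Rung0D3Rows`, which thereby become unconditional for `L ≥ 2`.
Everything is `[folklore]`.
-/

noncomputable section

open MeasureTheory
open Literature.MathematicalPhysics.QuantumFieldTheory

namespace Summit.QuantumFields.GaugeBoot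

namespace Rung0D3

variable (β : ℝ) (L : ℕ) [NeZero L]

/-- **Identification**: a raw word carried to `rep v` by `decide`-checked moves (zero net displacement after the moves)
has torus expectation `y v` at every coupling and on every torus (`LoopClasses.wilsonExpectation_wordLoop_canon`). [folklore] -/
theorem E_eq_y_of_canon (w : Word 3) (v : Fin 11) (ms : List (Move 3)) (rev : Bool) (k₁ k₂ : ℕ)
    (h : Word.disp (Word.acts ms w) = 0 ∧ Word.canon ms rev k₁ k₂ w = rep v) :
    wilsonExpectation (suRep 2) (β / (2 : ℕ)) (wordLoop (suRep 2) (0 : Site 3 L) w) = y β L v := by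
  show W β L w = y β L v
  unfold y W
  rw [← h.2]
  exact wilsonExpectation_wordLoop_canon (suRep 2) (continuous_suRep 2) _ _ _ _ _ _ h.1

/-- `⟨W_0(+0 +1 -0 -1)⟩ = y 1` (canonical form `-0 -1 +0 +1`). [folklore] -/
theorem E_plaq :
    wilsonExpectation (suRep 2) (β / (2 : ℕ)) (wordLoop (suRep 2) (0 : Site 3 L) (Word.plaquette 0 1)) = y β L 1 :=
  E_eq_y_of_canon β L _ 1 [] false 0 2 (by decide)

/-- `⟨W_0(+0 +1 -0 -1 +0 +1 -0 -1)⟩ = y 2` (canonical form `-0 -1 +0 +1 -0 -1 +0 +1`). [folklore] -/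
theorem E_plaq_1_true :
    wilsonExpectation (suRep 2) (β / (2 : ℕ)) (wordLoop (suRep 2) (0 : Site 3 L) (Word.plaquette 0 1 ++ plaqWord 0 1 true)) = y β L 2 :=
  E_eq_y_of_canon β L _ 2 [] false 0 2 (by decide)

/-- `⟨W_0(+0 +1 -0 -1 +1 +0 -1 -0)⟩ = y 0` (canonical form `∅`). [folklore] -/
theorem E_plaq_1_true_rev :
    wilsonExpectation (suRep 2) (β / (2 : ℕ)) (wordLoop (suRep 2) (0 : Site 3 L) (Word.plaquette 0 1 ++ (plaqWord 0 1 true).reverse)) = y β L 0 :=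
  E_eq_y_of_canon β L _ 0 [] false 0 0 (by decide)

/-- `⟨W_0(+0 +1 -0 -1 +0 -1 -0 +1)⟩ = y 4` (canonical form `-0 -1 -0 +1 +0 -1 +0 +1`). [folklore] -/
theorem E_plaq_1_false :
    wilsonExpectation (suRep 2) (β / (2 : ℕ)) (wordLoop (suRep 2) (0 : Site 3 L) (Word.plaquette 0 1 ++ plaqWord 0 1 false)) = y β L 4 :=
  E_eq_y_of_canon β L _ 4 [Move.perm (Equiv.swap 0 1)] true 0 6 (by decide)

/-- `⟨W_0(+0 +1 -0 -1 -1 +0 +1 -0)⟩ = y 3` (canonical form `-0 -0 -1 +0 +0 +1`). [folklore] -/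
theorem E_plaq_1_false_rev :
    wilsonExpectation (suRep 2) (β / (2 : ℕ)) (wordLoop (suRep 2) (0 : Site 3 L) (Word.plaquette 0 1 ++ (plaqWord 0 1 false).reverse)) = y β L 3 :=
  E_eq_y_of_canon β L _ 3 [Move.perm (Equiv.swap 0 1)] true 1 5 (by decide)

/-- `⟨W_0(+0 +1 -0 -1 +0 +2 -0 -2)⟩ = y 8` (canonical form `-0 -1 +0 +1 -0 -2 +0 +2`). [folklore] -/
theorem E_plaq_2_true :
    wilsonExpectation (suRep 2) (β / (2 : ℕ)) (wordLoop (suRep 2) (0 : Site 3 L) (Word.plaquette 0 1 ++ plaqWord 0 2 true)) = y β L 8 :=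
  E_eq_y_of_canon β L _ 8 [Move.refl 1, Move.refl 2] true 0 3 (by decide)

/-- `⟨W_0(+0 +1 -0 -1 +2 +0 -2 -0)⟩ = y 7` (canonical form `-0 -1 +0 -2 +1 +2`). [folklore] -/
theorem E_plaq_2_true_rev :
    wilsonExpectation (suRep 2) (β / (2 : ℕ)) (wordLoop (suRep 2) (0 : Site 3 L) (Word.plaquette 0 1 ++ (plaqWord 0 2 true).reverse)) = y β L 7 :=
  E_eq_y_of_canon β L _ 7 [Move.perm (Equiv.swap 0 1), Move.refl 1, Move.refl 2] false 1 0 (by decide)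

/-- `⟨W_0(+0 +1 -0 -1 +0 -2 -0 +2)⟩ = y 8` (canonical form `-0 -1 +0 +1 -0 -2 +0 +2`). [folklore] -/
theorem E_plaq_2_false :
    wilsonExpectation (suRep 2) (β / (2 : ℕ)) (wordLoop (suRep 2) (0 : Site 3 L) (Word.plaquette 0 1 ++ plaqWord 0 2 false)) = y β L 8 :=
  E_eq_y_of_canon β L _ 8 [Move.refl 1] true 0 3 (by decide)

/-- `⟨W_0(+0 +1 -0 -1 -2 +0 +2 -0)⟩ = y 7` (canonical form `-0 -1 +0 -2 +1 +2`). [folklore] -/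
theorem E_plaq_2_false_rev :
    wilsonExpectation (suRep 2) (β / (2 : ℕ)) (wordLoop (suRep 2) (0 : Site 3 L) (Word.plaquette 0 1 ++ (plaqWord 0 2 false).reverse)) = y β L 7 :=
  E_eq_y_of_canon β L _ 7 [Move.perm (Equiv.swap 0 1), Move.refl 1] false 1 0 (by decide)

/-- `⟨W_0(+0 +0 +1 -0 -1 -0 +0 +1 -0 -1)⟩ = y 3` (canonical form `-0 -0 -1 +0 +0 +1`). [folklore] -/
theorem E_spur_1_true :
    wilsonExpectation (suRep 2) (β / (2 : ℕ)) (wordLoop (suRep 2) (0 : Site 3 L) (Word.spurPlaquette 0 1 ++ plaqWord 0 1 true)) = y β L 3 :=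
  E_eq_y_of_canon β L _ 3 [] false 0 3 (by decide)

/-- `⟨W_0(+0 +0 +1 -0 -1 -0 +1 +0 -1 -0)⟩ = y 4` (canonical form `-0 -1 -0 +1 +0 -1 +0 +1`). [folklore] -/
theorem E_spur_1_true_rev :
    wilsonExpectation (suRep 2) (β / (2 : ℕ)) (wordLoop (suRep 2) (0 : Site 3 L) (Word.spurPlaquette 0 1 ++ (plaqWord 0 1 true).reverse)) = y β L 4 :=
  E_eq_y_of_canon β L _ 4 [] false 1 2 (by decide)

/-- `⟨W_0(+0 +0 +1 -0 -1 -0 +0 -1 -0 +1)⟩ = y 5` (canonical form `-0 -0 -1 +0 +1 +1 +0 -1`). [folklore] -/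
theorem E_spur_1_false :
    wilsonExpectation (suRep 2) (β / (2 : ℕ)) (wordLoop (suRep 2) (0 : Site 3 L) (Word.spurPlaquette 0 1 ++ plaqWord 0 1 false)) = y β L 5 :=
  E_eq_y_of_canon β L _ 5 [] true 0 6 (by decide)

/-- `⟨W_0(+0 +0 +1 -0 -1 -0 -1 +0 +1 -0)⟩ = y 6` (canonical form `-0 -1 -0 -1 +0 +1 +0 +1`). [folklore] -/
theorem E_spur_1_false_rev :
    wilsonExpectation (suRep 2) (β / (2 : ℕ)) (wordLoop (suRep 2) (0 : Site 3 L) (Word.spurPlaquette 0 1 ++ (plaqWord 0 1 false).reverse)) = y β L 6 :=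
  E_eq_y_of_canon β L _ 6 [] false 1 2 (by decide)

/-- `⟨W_0(+0 +0 +1 -0 -1 -0 +0 +2 -0 -2)⟩ = y 9` (canonical form `-0 -0 -1 +0 +1 -2 +0 +2`). [folklore] -/
theorem E_spur_2_true :
    wilsonExpectation (suRep 2) (β / (2 : ℕ)) (wordLoop (suRep 2) (0 : Site 3 L) (Word.spurPlaquette 0 1 ++ plaqWord 0 2 true)) = y β L 9 :=
  E_eq_y_of_canon β L _ 9 [Move.perm (Equiv.swap 1 2), Move.refl 1, Move.refl 2] true 0 6 (by decide)

/-- `⟨W_0(+0 +0 +1 -0 -1 -0 +2 +0 -2 -0)⟩ = y 10` (canonical form `-0 -1 -0 +1 +0 -2 +0 +2`). [folklore] -/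
theorem E_spur_2_true_rev :
    wilsonExpectation (suRep 2) (β / (2 : ℕ)) (wordLoop (suRep 2) (0 : Site 3 L) (Word.spurPlaquette 0 1 ++ (plaqWord 0 2 true).reverse)) = y β L 10 :=
  E_eq_y_of_canon β L _ 10 [Move.perm (Equiv.swap 1 2), Move.refl 1, Move.refl 2] true 1 7 (by decide)

/-- `⟨W_0(+0 +0 +1 -0 -1 -0 +0 -2 -0 +2)⟩ = y 9` (canonical form `-0 -0 -1 +0 +1 -2 +0 +2`). [folklore] -/
theorem E_spur_2_false :
    wilsonExpectation (suRep 2) (β / (2 : ℕ)) (wordLoop (suRep 2) (0 : Site 3 L) (Word.spurPlaquette 0 1 ++ plaqWord 0 2 false)) = y β L 9 :=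
  E_eq_y_of_canon β L _ 9 [Move.perm (Equiv.swap 1 2), Move.refl 1] true 0 6 (by decide)

/-- `⟨W_0(+0 +0 +1 -0 -1 -0 -2 +0 +2 -0)⟩ = y 10` (canonical form `-0 -1 -0 +1 +0 -2 +0 +2`). [folklore] -/
theorem E_spur_2_false_rev :
    wilsonExpectation (suRep 2) (β / (2 : ℕ)) (wordLoop (suRep 2) (0 : Site 3 L) (Word.spurPlaquette 0 1 ++ (plaqWord 0 2 false).reverse)) = y β L 10 :=
  E_eq_y_of_canon β L _ 10 [Move.perm (Equiv.swap 1 2), Move.refl 1] true 1 7 (by decide)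

/-- **(1eq) of the rung-0 `D = 3` problem files, as a theorem** (raw form, standard coupling `β`, every torus side
`L ≥ 2`): `3·y1 + (β/2)·(y2 − 1 + y4 − y3 + 2(y8 − y7)) = 0`. [folklore] -/
theorem oneEq (hL : (1 : ZMod L) ≠ 0) :
    3 * y β L 1 + β / 2 * (y β L 2 - 1 + y β L 4 - y β L 3 + 2 * (y β L 8 - y β L 7)) = 0 := by
  have h := oneEq_su_two_wordLoop (L := L) hL (β / (2 : ℕ)) (0 : Site 3 L) (μ := 0) (ν := 1) (by decide)
  rw [univ_erase_zero_fin_three, Finset.sum_pair (by decide)] at h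
  simp only [Fintype.sum_bool, E_plaq, E_plaq_1_true, E_plaq_1_true_rev, E_plaq_1_false, E_plaq_1_false_rev, E_plaq_2_true, E_plaq_2_true_rev, E_plaq_2_false, E_plaq_2_false_rev] at h
  rw [y_zero] at h
  push_cast at h
  linear_combination h

/-- **(2eq) of the rung-0 `D = 3` problem files, as a theorem** (raw form): `(β/2)·(y3 − y4 + y5 − y6 + 2(y9 − y10)) = 0`.
[folklore] -/
theorem twoEq (hL : (1 : ZMod L) ≠ 0) :
    β / 2 * (y β L 3 - y β L 4 + y β L 5 - y β L 6 + 2 * (y β L 9 - y β L 10)) = 0 := by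
  have h := twoEq_su_two_wordLoop (L := L) hL (β / (2 : ℕ)) (0 : Site 3 L) (μ := 0) (ν := 1) (by decide)
  rw [univ_erase_zero_fin_three, Finset.sum_pair (by decide)] at h
  simp only [Fintype.sum_bool, E_spur_1_true, E_spur_1_true_rev, E_spur_1_false, E_spur_1_false_rev, E_spur_2_true, E_spur_2_true_rev, E_spur_2_false, E_spur_2_false_rev] at h
  push_cast at h
  linear_combination h

/-- **(1eq) normalised as in the problem files** (`β ≠ 0`, `L ≥ 2`):
`−1 + (6/β)·y1 + y2 − y3 + y4 − 2y7 + 2y8 = 0`. [folklore] -/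
theorem oneEq_y (hβ : β ≠ 0) (hL : 2 ≤ L) :
    -1 + 6 / β * y β L 1 + y β L 2 - y β L 3 + y β L 4 - 2 * y β L 7 + 2 * y β L 8 = 0 := by
  have h := oneEq β L (zmod_one_ne_zero hL)
  field_simp
  linear_combination 2 * h

/-- **(1eq) with the printed coefficient**: for any `c` with `c·β = 6` (e.g. `c = 6` at `β = 1`, `c = 12` at `β = 1/2`,
`c = 4/3` at `β = 9/2`), `−1 + c·y1 + y2 − y3 + y4 − 2y7 + 2y8 = 0` — the hypothesis `h1eq` of `Rows/Rung0D3Rows*` verbatim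
(`L ≥ 2`). [folklore] -/
theorem oneEq_y_of (hL : 2 ≤ L) (c : ℝ) (hc : c * β = 6) :
    -1 + c * y β L 1 + y β L 2 - y β L 3 + y β L 4 - 2 * y β L 7 + 2 * y β L 8 = 0 := by
  have hβ : β ≠ 0 := by rintro rfl; norm_num at hc
  have h := oneEq_y β L hβ hL
  have hc' : c = 6 / β := by rw [eq_div_iff hβ]; exact hc
  rwa [hc']

/-- **(2eq) normalised as in the problem files** (`β ≠ 0`, `L ≥ 2`): `−y3 + y4 − y5 + y6 − 2y9 + 2y10 = 0` — the
hypothesis `h2eq` of `Rows/Rung0D3Rows*` verbatim. [folklore] -/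
theorem twoEq_y (hβ : β ≠ 0) (hL : 2 ≤ L) :
    -y β L 3 + y β L 4 - y β L 5 + y β L 6 - 2 * y β L 9 + 2 * y β L 10 = 0 := by
  have h := twoEq β L (zmod_one_ne_zero hL)
  have h2 : β / 2 ≠ 0 := div_ne_zero hβ two_ne_zero
  have h3 := (mul_eq_zero.1 h).resolve_left h2
  linear_combination -h3

end Rung0D3

end Summit.QuantumFields.GaugeBoot

end
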